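import Summits.AnomalousDissipation.AnomalousDissipation.Theorems.ScalarAnomalySteadySourceFormal.Negative.WienLimit

/-!
# Negative knowledge for the crux `ScalarAnomalySteadySourceFormal` (stmt-AnomalousDissipation-0448), X-f:
# Wiener-class stirring — outer truncation and the per-`T` dissipation inequality

Certified copy of §12.6 of the cdisprove work file.  The shift bound splits as `wInner + wOuter`; the
outer series is removed by the truncation `K' → ∞`: a pigeonhole over `K' ∈ [N,2N)` (each shift `q`
meets at most `2r_q` square layers, `sum_Ico_integral_slayerSum_le_tail`) bounds it by
`Ω(N) = ∑' q 4 a_q r_q (2 + r_q) ∫ sqTail θ (N - r_q)`, and `Ω(N) → 0` by **Tannery's theorem**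
(`tendsto_tsum_of_dominated_convergence`; the SECOND MOMENT `∑ r_q² a_q < ∞` is the dominating
series) and the vanishing of the time-integrated spectral tail.  Results: `wien_compl_finset_dissipation_le`,
`wien_finset_dissipation_le`, `wien_perT_dissipation_le`:
`2ν ∫⁻_{(0,T)} ‖∇θ‖² ≤ ofReal (‖θ₀‖² + 16π²νK² ∫‖θ‖² + 4π ∑' q ∫ wInner a K y q + 2 η_K ∫‖θ‖)` —
in particular the dissipation integral is FINITE under Wiener-class stirring.

Supports stmt-AnomalousDissipation-0448 (the Wiener-class no-go, files `Wien*`).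
-/

set_option linter.dupNamespace false

noncomputable section

open scoped BigOperators Topology ENNReal NNReal InnerProductSpace ContDiff
open Filter Set Function MeasureTheory UnitAddTorus Complex

namespace Summit.AnomalousDissipation.AnomalousDissipation.Theorems.ScalarAnomalySteadySourceFormal.Negative

open Literature.Analysis
open Literature.Analysis.FunctionSpaces Literature.Analysis.FunctionSpaces.Torus
open Literature.Analysis.FluidPDE Literature.Analysis.FluidPDE.Torus

/-- The frequency lattice `ℤ²` (local notation). -/
local notation "ℤ²" => Fin 2 → ℤ

section Split

variable {a : ℤ² → ℝ} {Y : ℤ² → ℂ} {V : ℝ}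

/-- Inner part of the shift bound. [folklore] -/
def wInner (a : ℤ² → ℝ) (K : ℤ) (Y : ℤ² → ℂ) (q : ℤ²) : ℝ :=
  2 * a q * ((K + qrad q) * slayerSum (K - qrad q) (K + qrad q) Y)

/-- `wFluxBound = wInner K + wInner K'` (the outer part has the same shape). [folklore] -/
theorem wFluxBound_eq (a : ℤ² → ℝ) (K K' : ℤ) (Y : ℤ² → ℂ) (q : ℤ²) :
    wFluxBound a K K' Y q = wInner a K Y q + wInner a K' Y q := by
  unfold wFluxBound wInner; ring

/-- `0 ≤ wInner`. [folklore] -/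
theorem wInner_nonneg (ha : ∀ q, 0 ≤ a q) {K : ℤ} (hK : 0 ≤ K) (Y : ℤ² → ℂ) (q : ℤ²) : 0 ≤ wInner a K Y q := by
  unfold wInner
  have := ha q; have := slayerSum_nonneg (K - qrad q) (K + qrad q) Y
  have hK0 : (0 : ℝ) ≤ K := by exact_mod_cast hK
  positivity

/-- `wInner ≤ 2 K V a_q + 2 V (r_q a_q)`. [folklore] -/
theorem wInner_le (ha : ∀ q, 0 ≤ a q) (hV : ∀ F : Finset ℤ², ∑ p ∈ F, ‖Y p‖ ^ 2 ≤ V) {K : ℤ} (hK : 0 ≤ K) (q : ℤ²) :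
    wInner a K Y q ≤ 2 * K * V * a q + 2 * V * (qrad q * a q) := by
  unfold wInner
  have hV0 : 0 ≤ V := (Finset.sum_nonneg fun _ _ => sq_nonneg _).trans (hV ∅)
  have h1 := slayerSum_le_of_bessel hV (K - qrad q) (K + qrad q)
  have hK0 : (0 : ℝ) ≤ K := by exact_mod_cast hK
  have haq := ha q
  have hr : (0 : ℝ) ≤ qrad q := (qrad q).cast_nonneg
  have e1 : (K + qrad q) * slayerSum (K - qrad q) (K + qrad q) Y ≤ (K + qrad q) * V := mul_le_mul_of_nonneg_left h1 (by positivity)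
  nlinarith [e1, haq, hV0, hr]

end Split

section WOuter

variable {ν : ℝ} {C : ℝ → ℤ² → EuclideanSpace ℂ (Fin 2)} {a : ℤ² → ℝ}
  {u : ℝ → UnitAddTorus (Fin 2) → EuclideanSpace ℝ (Fin 2)} {h θ₀ : UnitAddTorus (Fin 2) → ℝ}
  {θ : ℝ → UnitAddTorus (Fin 2) → ℝ}

/-- Integrability of `wInner` along the solution. [folklore] -/
theorem integrableOn_wInner {T : ℝ} (hw : IsWeakScalarTransportForcedOn T ν u (fun _ => h) θ₀ θ) (K : ℤ) (q : ℤ²) :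
    IntegrableOn (fun t => wInner a K (modes θ t) q) (Ioo 0 T) volume := by
  unfold wInner slayerSum
  have h1 := forced_integrableOn_sum_sq_modes hw (slayer (K - qrad q) (K + qrad q)) (fun _ => 1)
  simp only [one_mul] at h1
  exact (h1.const_mul _).const_mul _

/-- `0 ≤ ∫ wInner`. [folklore] -/
theorem integral_wInner_nonneg (hCa : ∀ s q, ‖C s q‖ ≤ a q) {K : ℤ} (hK : 0 ≤ K) (T : ℝ) (q : ℤ²) :
    0 ≤ ∫ t in Ioo 0 T, wInner a K (modes θ t) q :=
  setIntegral_nonneg measurableSet_Ioo fun _ _ => wInner_nonneg (fun q => (norm_nonneg _).trans (hCa 0 q)) hK _ q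

/-- `∫ wInner(q) ≤ (2K a_q + 2 r_q a_q) ∫ ‖θ‖²`. [folklore] -/
theorem integral_wInner_le {T : ℝ} (hw : IsWeakScalarTransportForcedOn T ν u (fun _ => h) θ₀ θ) (hCa : ∀ s q, ‖C s q‖ ≤ a q)
    {K : ℤ} (hK : 0 ≤ K) (q : ℤ²) :
    ∫ t in Ioo 0 T, wInner a K (modes θ t) q ≤ (2 * K * a q + 2 * (qrad q * a q)) * ∫ t in Ioo 0 T, scalarL2Sq (θ t) := by
  have ha : ∀ q, 0 ≤ a q := fun q => (norm_nonneg _).trans (hCa 0 q)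
  rw [← integral_const_mul]
  refine integral_mono_ae (integrableOn_wInner hw K q) ((forced_integrableOn_scalarL2Sq hw).const_mul _) ?_
  filter_upwards [forced_ae_memLp_two hw] with t ht
  have hV : ∀ F : Finset ℤ², ∑ p ∈ F, ‖modes θ t p‖ ^ 2 ≤ scalarL2Sq (θ t) := fun F => sum_sq_norm_mFourierCoeff_le_integral_sq ht F
  have := wInner_le ha hV hK q (Y := modes θ t)
  linarith [this]

/-- Summability of the series of time integrals of `wInner`. [folklore] -/
theorem summable_integral_wInner {T : ℝ} (hw : IsWeakScalarTransportForcedOn T ν u (fun _ => h) θ₀ θ) (hCa : ∀ s q, ‖C s q‖ ≤ a q)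
    (hsa : Summable a) (hsa1 : Summable fun q => (qrad q : ℝ) * a q) {K : ℤ} (hK : 0 ≤ K) :
    Summable fun q => ∫ t in Ioo 0 T, wInner a K (modes θ t) q :=
  Summable.of_nonneg_of_le (integral_wInner_nonneg hCa hK T) (integral_wInner_le hw hCa hK)
    (((hsa.mul_left _).add (hsa1.mul_left _)).mul_right _)

/-- Splitting the series of time integrals of the shift bound. [folklore] -/
theorem tsum_integral_wFluxBound_eq {T : ℝ} (hw : IsWeakScalarTransportForcedOn T ν u (fun _ => h) θ₀ θ)
    (hCa : ∀ s q, ‖C s q‖ ≤ a q) (hsa : Summable a) (hsa1 : Summable fun q => (qrad q : ℝ) * a q)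
    {K K' : ℤ} (hK : 0 ≤ K) (hK' : 0 ≤ K') :
    ∑' q, ∫ t in Ioo 0 T, wFluxBound a K K' (modes θ t) q =
      (∑' q, ∫ t in Ioo 0 T, wInner a K (modes θ t) q) + ∑' q, ∫ t in Ioo 0 T, wInner a K' (modes θ t) q := by
  rw [← Summable.tsum_add (summable_integral_wInner hw hCa hsa hsa1 hK) (summable_integral_wInner hw hCa hsa hsa1 hK')]
  refine tsum_congr fun q => ?_
  rw [← integral_add (integrableOn_wInner hw K q) (integrableOn_wInner hw K' q)]
  exact integral_congr_ae (Eventually.of_forall fun t => wFluxBound_eq a K K' (modes θ t) q)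

/-- **Each shift meets at most `2r` square layers, against the tail**:
`∑_{K'∈[N,N+n)} ∫ slayerSum (K'-r) (K'+r) ≤ 2r ∫ sqTail θ (N - r)`. [folklore] -/
theorem sum_Ico_integral_slayerSum_le_tail (hw : IsWeakScalarTransportForced ν u (fun _ => h) θ₀ θ) {T : ℝ} (hT : 0 < T)
    (r : ℕ) (N : ℤ) (n : ℕ) :
    ∑ K' ∈ Finset.Ico N (N + n), ∫ t in Ioo 0 T, slayerSum (K' - r) (K' + r) (modes θ t) ≤
      2 * r * ∫ t in Ioo 0 T, sqTail θ (N - r) t := by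
  classical
  have hwT := hw T hT
  set I := Finset.Ico N (N + n) with hI
  have hint : ∀ K ∈ I, IntegrableOn (fun t => slayerSum (K - r) (K + r) (modes θ t)) (Ioo 0 T) volume := by
    intro K _
    simpa [slayerSum] using forced_integrableOn_sum_sq_modes hwT (slayer (K - r) (K + r)) (fun _ => 1)
  have hiTail : IntegrableOn (fun t => sqTail θ (N - r) t) (Ioo 0 T) volume := by
    unfold sqTail
    exact (forced_integrableOn_scalarL2Sq hwT).sub (integrable_finsetSum _ fun p _ => forced_integrableOn_sq_modes hwT p)
  have hdisj : Disjoint (box (N - r) (N - r)) (slayer (N - r) (N + n + r)) := by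
    rw [Finset.disjoint_left]
    intro p hp hp'
    rw [mem_box] at hp
    rw [mem_slayer] at hp'
    rcases hp'.2 with h | h <;> omega
  rw [← integral_finsetSum _ hint, ← integral_const_mul]
  refine integral_mono_ae (integrable_finsetSum _ hint) (hiTail.const_mul _) ?_
  filter_upwards [forced_ae_sum_sq_modes_le hwT (box (N - r) (N - r) ∪ slayer (N - r) (N + n + r))] with t ht
  rw [Finset.sum_union hdisj] at ht
  have htail : ∑ p ∈ slayer (N - r) (N + n + r), ‖modes θ t p‖ ^ 2 ≤ sqTail θ (N - r) t := by
    unfold sqTail; linarith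
  calc ∑ K ∈ I, slayerSum (K - r) (K + r) (modes θ t)
      ≤ 2 * r * ∑ p ∈ slayer (N - r) (N + n + r), ‖modes θ t p‖ ^ 2 := sum_Ico_slayerSum_le r N n (modes θ t)
    _ ≤ 2 * r * sqTail θ (N - r) t := by gcongr

/-- `0 ≤ ∫ sqTail` (Bessel, a.e.). [folklore] -/
theorem integral_sqTail_nonneg (hw : IsWeakScalarTransportForced ν u (fun _ => h) θ₀ θ) {T : ℝ} (hT : 0 < T) (L : ℤ) :
    0 ≤ ∫ t in Ioo 0 T, sqTail θ L t := by
  refine setIntegral_nonneg_of_ae_restrict ?_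
  filter_upwards [forced_ae_sum_sq_modes_le (hw T hT) (box L L)] with t ht
  simp only [Pi.zero_apply]; unfold sqTail; linarith

/-- `∫ sqTail ≤ ∫ ‖θ‖²`. [folklore] -/
theorem integral_sqTail_le (hw : IsWeakScalarTransportForced ν u (fun _ => h) θ₀ θ) {T : ℝ} (hT : 0 < T) (L : ℤ) :
    ∫ t in Ioo 0 T, sqTail θ L t ≤ ∫ t in Ioo 0 T, scalarL2Sq (θ t) := by
  have hwT := hw T hT
  have hiTail : IntegrableOn (fun t => sqTail θ L t) (Ioo 0 T) volume := by
    unfold sqTail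
    exact (forced_integrableOn_scalarL2Sq hwT).sub (integrable_finsetSum _ fun p _ => forced_integrableOn_sq_modes hwT p)
  refine integral_mono_ae hiTail (forced_integrableOn_scalarL2Sq hwT) (Eventually.of_forall fun t => ?_)
  unfold sqTail
  have := Finset.sum_nonneg (fun p (_ : p ∈ box L L) => sq_nonneg ‖modes θ t p‖)
  linarith

/-- The outer error functional `Ω(N) = ∑' q 4 a_q r_q (2 + r_q) ∫ sqTail θ (N - r_q)`. [folklore] -/
def wOmega (a : ℤ² → ℝ) (θ : ℝ → UnitAddTorus (Fin 2) → ℝ) (T : ℝ) (N : ℕ) : ℝ :=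
  ∑' q, 4 * a q * qrad q * (2 + qrad q) * ∫ t in Ioo 0 T, sqTail θ ((N : ℤ) - qrad q) t

/-- The dominating series of `Ω`: `4 a_q r_q (2 + r_q) ∫‖θ‖²`. [folklore] -/
theorem summable_wOmega_bound (hsa1 : Summable fun q => (qrad q : ℝ) * a q) (hsa2 : Summable fun q => (qrad q : ℝ) ^ 2 * a q)
    (W : ℝ) : Summable fun q => 4 * a q * qrad q * (2 + qrad q) * W := by
  have : (fun q => 4 * a q * qrad q * (2 + qrad q) * W) = fun q => 8 * W * ((qrad q : ℝ) * a q) + 4 * W * ((qrad q : ℝ) ^ 2 * a q) := by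
    funext q; ring
  rw [this]
  exact (hsa1.mul_left _).add (hsa2.mul_left _)

/-- **`Ω(N) → 0`** (Tannery + vanishing of the integrated spectral tail). [folklore] -/
theorem tendsto_wOmega (hw : IsWeakScalarTransportForced ν u (fun _ => h) θ₀ θ) (hCa : ∀ s q, ‖C s q‖ ≤ a q)
    (hsa1 : Summable fun q => (qrad q : ℝ) * a q) (hsa2 : Summable fun q => (qrad q : ℝ) ^ 2 * a q) {T : ℝ} (hT : 0 < T) :
    Tendsto (wOmega a θ T) atTop (nhds 0) := by
  have ha : ∀ q, 0 ≤ a q := fun q => (norm_nonneg _).trans (hCa 0 q)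
  obtain ⟨W, hW⟩ : ∃ W : ℝ, W = ∫ t in Ioo 0 T, scalarL2Sq (θ t) := ⟨_, rfl⟩
  -- the terms, as functions of `N`
  obtain ⟨f, hf⟩ : ∃ f : ℕ → ℤ² → ℝ, f = fun (N : ℕ) (q : ℤ²) => 4 * a q * qrad q * (2 + qrad q) * ∫ t in Ioo 0 T, sqTail θ ((N : ℤ) - qrad q) t :=
    ⟨_, rfl⟩
  have hf0 : ∀ N q, 0 ≤ f N q := by
    intro N q
    rw [hf]
    have hr : (0 : ℝ) ≤ qrad q := (qrad q).cast_nonneg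
    have haq := ha q
    have := integral_sqTail_nonneg hw hT ((N : ℤ) - qrad q)
    positivity
  have hfb : ∀ N q, f N q ≤ 4 * a q * qrad q * (2 + qrad q) * W := by
    intro N q
    rw [hf, hW]
    have hr : (0 : ℝ) ≤ qrad q := (qrad q).cast_nonneg
    have haq := ha q
    exact mul_le_mul_of_nonneg_left (integral_sqTail_le hw hT _) (by positivity)
  have hlim : ∀ q, Tendsto (fun N => f N q) atTop (nhds 0) := by
    intro q
    have h1 := (tendsto_integral_sqTail hw hT).comp (tendsto_sub_atTop_nat (qrad q))
    have h2 : Tendsto (fun N : ℕ => ∫ t in Ioo 0 T, sqTail θ ((N : ℤ) - qrad q) t) atTop (nhds 0) := by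
      refine h1.congr' ?_
      filter_upwards [eventually_ge_atTop (qrad q)] with N hN
      have e : (((N - qrad q : ℕ) : ℤ)) = (N : ℤ) - qrad q := by push_cast [Nat.cast_sub hN]; rfl
      simp only [Function.comp, e]
    have h3 := h2.const_mul (4 * a q * qrad q * (2 + qrad q))
    rw [mul_zero] at h3
    rw [hf]; exact h3
  have key := tendsto_tsum_of_dominated_convergence (𝓕 := atTop) (f := f) (g := fun _ => (0 : ℝ))
    (bound := fun q => 4 * a q * qrad q * (2 + qrad q) * W) (summable_wOmega_bound hsa1 hsa2 W) hlim
    (Eventually.of_forall fun N q => by rw [Real.norm_eq_abs, abs_of_nonneg (hf0 N q)]; exact hfb N q)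
  rw [tsum_zero] at key
  have e : (fun N => ∑' q, f N q) = wOmega a θ T := by funext N; rw [wOmega, hf]
  rwa [e] at key

/-- **Outer pigeonhole**: for `N ≥ 1` some `K' ∈ [N,2N)` has `∑' q ∫ wInner a K' y q ≤ Ω(N)`. [folklore] -/
theorem exists_outer_small (hw : IsWeakScalarTransportForced ν u (fun _ => h) θ₀ θ) (hCa : ∀ s q, ‖C s q‖ ≤ a q)
    (hsa : Summable a) (hsa1 : Summable fun q => (qrad q : ℝ) * a q) (hsa2 : Summable fun q => (qrad q : ℝ) ^ 2 * a q)
    {T : ℝ} (hT : 0 < T) {N : ℕ} (hN : 1 ≤ N) :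
    ∃ K' ∈ Finset.Ico (N : ℤ) (N + N), ∑' q, ∫ t in Ioo 0 T, wInner a K' (modes θ t) q ≤ wOmega a θ T N := by
  classical
  have hwT := hw T hT
  have ha : ∀ q, 0 ≤ a q := fun q => (norm_nonneg _).trans (hCa 0 q)
  set I := Finset.Ico (N : ℤ) (N + N) with hI
  have hIcard : I.card = N := by rw [hI, Int.card_Ico]; omega
  have hIne : I.Nonempty := by rw [← Finset.card_pos, hIcard]; omega
  have hK0 : ∀ K' ∈ I, (0 : ℤ) ≤ K' := fun K' hK' => le_trans (Int.natCast_nonneg N) (Finset.mem_Ico.1 hK').1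
  have hNpos : (0 : ℝ) < N := by exact_mod_cast hN
  -- sum over the layers, series by series
  have hsum : ∑ K' ∈ I, ∑' q, ∫ t in Ioo 0 T, wInner a K' (modes θ t) q ≤ N * wOmega a θ T N := by
    rw [← Summable.tsum_finsetSum (fun K' hK' => summable_integral_wInner hwT hCa hsa hsa1 (hK0 K' hK'))]
    unfold wOmega
    rw [← tsum_mul_left]
    have hΩs : Summable fun q => 4 * a q * qrad q * (2 + qrad q) * ∫ t in Ioo 0 T, sqTail θ ((N : ℤ) - qrad q) t := by
      refine Summable.of_nonneg_of_le (fun q => ?_) (fun q => ?_) (summable_wOmega_bound hsa1 hsa2 (∫ t in Ioo 0 T, scalarL2Sq (θ t)))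
      · have hr : (0 : ℝ) ≤ qrad q := (qrad q).cast_nonneg
        have haq := ha q
        have := integral_sqTail_nonneg hw hT ((N : ℤ) - qrad q)
        positivity
      · have hr : (0 : ℝ) ≤ qrad q := (qrad q).cast_nonneg
        have haq := ha q
        exact mul_le_mul_of_nonneg_left (integral_sqTail_le hw hT _) (by positivity)
    refine Summable.tsum_le_tsum (fun q => ?_) (summable_sum fun K' hK' => summable_integral_wInner hwT hCa hsa hsa1 (hK0 K' hK'))
      (hΩs.mul_left _)
    -- fixed shift `q`
    have hr : (0 : ℝ) ≤ qrad q := (qrad q).cast_nonneg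
    have haq := ha q
    have hN1r : (1 : ℝ) ≤ N := by exact_mod_cast hN
    have hlay := sum_Ico_integral_slayerSum_le_tail hw hT (qrad q) (N : ℤ) N
    have htail0 := integral_sqTail_nonneg hw hT ((N : ℤ) - qrad q)
    have e1 : ∀ K' ∈ I, ∫ t in Ioo 0 T, wInner a K' (modes θ t) q =
        2 * a q * (K' + qrad q) * ∫ t in Ioo 0 T, slayerSum (K' - qrad q) (K' + qrad q) (modes θ t) := by
      intro K' _
      unfold wInner
      rw [integral_const_mul, integral_const_mul]; ring
    rw [Finset.sum_congr rfl e1]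
    have e2 : ∀ K' ∈ I, 2 * a q * (K' + qrad q) * ∫ t in Ioo 0 T, slayerSum (K' - qrad q) (K' + qrad q) (modes θ t) ≤
        2 * a q * (2 * N + qrad q) * ∫ t in Ioo 0 T, slayerSum (K' - qrad q) (K' + qrad q) (modes θ t) := by
      intro K' hK'
      have h1 : (K' : ℝ) < N + N := by exact_mod_cast (Finset.mem_Ico.1 hK').2
      have h0 := setIntegral_nonneg (μ := volume) (s := Ioo 0 T) measurableSet_Ioo
        (fun t _ => slayerSum_nonneg (K' - qrad q) (K' + qrad q) (modes θ t))
      have : 2 * a q * (K' + qrad q) ≤ 2 * a q * (2 * N + qrad q) := by nlinarith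
      exact mul_le_mul_of_nonneg_right this h0
    refine (Finset.sum_le_sum e2).trans ?_
    rw [← Finset.mul_sum]
    calc 2 * a q * (2 * N + qrad q) * ∑ K' ∈ I, ∫ t in Ioo 0 T, slayerSum (K' - qrad q) (K' + qrad q) (modes θ t)
        ≤ 2 * a q * (2 * N + qrad q) * (2 * qrad q * ∫ t in Ioo 0 T, sqTail θ ((N : ℤ) - qrad q) t) :=
          mul_le_mul_of_nonneg_left hlay (by positivity)
      _ ≤ 2 * a q * (2 * N + N * qrad q) * (2 * qrad q * ∫ t in Ioo 0 T, sqTail θ ((N : ℤ) - qrad q) t) := by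
          have h1 : (qrad q : ℝ) ≤ N * qrad q := by nlinarith [mul_nonneg (sub_nonneg.2 hN1r) hr]
          have h2 : 0 ≤ 2 * qrad q * ∫ t in Ioo 0 T, sqTail θ ((N : ℤ) - qrad q) t := by positivity
          have : 2 * a q * (2 * N + qrad q) ≤ 2 * a q * (2 * N + N * qrad q) := by nlinarith [mul_nonneg haq (sub_nonneg.2 h1)]
          exact mul_le_mul_of_nonneg_right this h2
      _ = N * (4 * a q * qrad q * (2 + qrad q) * ∫ t in Ioo 0 T, sqTail θ ((N : ℤ) - qrad q) t) := by ring
  have hsum' : ∑ K' ∈ I, ∑' q, ∫ t in Ioo 0 T, wInner a K' (modes θ t) q ≤ ∑ K' ∈ I, wOmega a θ T N := by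
    rw [Finset.sum_const, hIcard, nsmul_eq_mul]; exact hsum
  exact Finset.exists_le_of_sum_le hIne hsum'

/-- **Finite sums of complement modes** (Wiener-class stirring): for every finite `F` outside `sbox K`,
`2ν ∑_{p∈F} 4π²|p|² q_p ≤ ‖θ₀‖² + 4π ∑' q ∫ wInner a K y q + 2 η_K ∫‖θ‖`. [folklore] -/
theorem wien_compl_finset_dissipation_le (hw : IsWeakScalarTransportForced ν u (fun _ => h) θ₀ θ) (hν : 0 ≤ ν)
    (hu : ∀ s, u s = wienField (C s)) (hCa : ∀ s q, ‖C s q‖ ≤ a q) (hsa : Summable a)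
    (hsa1 : Summable fun q => (qrad q : ℝ) * a q) (hsa2 : Summable fun q => (qrad q : ℝ) ^ 2 * a q)
    (hsymm : ∀ s q, C s (-q) = EuclideanSpace.conjVec (C s q)) (hcont : ∀ q, Continuous fun s => C s q)
    (htrans : ∀ s q, zdot q (C s q) = 0) (hh : MemLp h 2 volume) (hθ₀ : MemLp θ₀ 2 volume)
    {K : ℤ} (hK : 0 ≤ K) {T : ℝ} (hT : 0 < T) {F : Finset ℤ²} (hF : ∀ p ∈ F, p ∉ box K K) :
    2 * ν * ∑ p ∈ F, 4 * Real.pi ^ 2 * freqNormSq p * modeEnergyInt θ T p ≤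
      scalarL2Sq θ₀ + 4 * Real.pi * (∑' q, ∫ t in Ioo 0 T, wInner a K (modes θ t) q) +
        2 * sourceTailMass K K h * ∫ t in Ioo 0 T, Real.sqrt (scalarL2Sq (θ t)) := by
  classical
  have hhi : Integrable h volume := hh.integrable one_le_two
  have hwT := hw T hT
  set G : ℝ := ∑' q, ∫ t in Ioo 0 T, wInner a K (modes θ t) q with hG
  set W : ℝ := ∫ t in Ioo 0 T, Real.sqrt (scalarL2Sq (θ t)) with hW
  set C₀ : ℝ := scalarL2Sq θ₀ + 4 * Real.pi * G + 2 * sourceTailMass K K h * W with hC₀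
  have hπ := Real.pi_pos
  obtain ⟨L, hL⟩ : ∃ L : ℕ, ∀ p ∈ F, |p 0| ≤ L ∧ |p 1| ≤ L := by
    refine ⟨F.sup fun p => (|p 0|).toNat + (|p 1|).toNat, fun p hp => ?_⟩
    have h1 : (|p 0|).toNat + (|p 1|).toNat ≤ F.sup fun p => (|p 0|).toNat + (|p 1|).toNat :=
      Finset.le_sup (f := fun p : ℤ² => (|p 0|).toNat + (|p 1|).toNat) hp
    constructor <;> omega
  have key : ∀ N : ℕ, 1 ≤ N → (L : ℤ) ≤ N → K ≤ N →
      2 * ν * ∑ p ∈ F, 4 * Real.pi ^ 2 * freqNormSq p * modeEnergyInt θ T p ≤ C₀ + 4 * Real.pi * wOmega a θ T N := by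
    intro N hN1 hNL hNK
    obtain ⟨K', hK'I, hK'⟩ := exists_outer_small hw hCa hsa hsa1 hsa2 hT hN1
    rw [Finset.mem_Ico] at hK'I
    have hK'0 : (0 : ℤ) ≤ K' := le_trans (Int.natCast_nonneg N) hK'I.1
    have hband := wband_modes_le hw hu hCa hsa hsa1 hsymm hcont htrans hhi hθ₀ hT hK hK'0
    rw [integral_bandDiss_eq hw hT, tsum_integral_wFluxBound_eq hwT hCa hsa hsa1 hK hK'0] at hband
    have hFsub : F ⊆ box K' K' \ box K K := by
      intro p hp
      rw [Finset.mem_sdiff, mem_box]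
      refine ⟨⟨?_, ?_⟩, hF p hp⟩
      · have := (hL p hp).1; omega
      · have := (hL p hp).2; omega
    have hmono : ∑ p ∈ F, 4 * Real.pi ^ 2 * freqNormSq p * modeEnergyInt θ T p ≤
        ∑ p ∈ box K' K' \ box K K, 4 * Real.pi ^ 2 * freqNormSq p * ∫ t in Ioo 0 T, ‖modes θ t p‖ ^ 2 :=
      Finset.sum_le_sum_of_subset_of_nonneg hFsub fun p _ _ => by
        have := freqNormSq_nonneg p; have := modeEnergyInt_nonneg θ T p
        unfold modeEnergyInt at this; positivity
    have hsm := sourceMass_le_sourceTailMass hh (𝔅 := box K' K' \ box K K) fun p hp => (Finset.mem_sdiff.1 hp).2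
    calc 2 * ν * ∑ p ∈ F, 4 * Real.pi ^ 2 * freqNormSq p * modeEnergyInt θ T p
        ≤ 2 * ν * ∑ p ∈ box K' K' \ box K K, 4 * Real.pi ^ 2 * freqNormSq p * ∫ t in Ioo 0 T, ‖modes θ t p‖ ^ 2 := by gcongr
      _ ≤ scalarL2Sq θ₀ + 4 * Real.pi * (G + ∑' q, ∫ t in Ioo 0 T, wInner a K' (modes θ t) q) +
          2 * sourceMass (box K' K' \ box K K) h * W := hband
      _ ≤ scalarL2Sq θ₀ + 4 * Real.pi * (G + wOmega a θ T N) + 2 * sourceTailMass K K h * W := by gcongr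
      _ = C₀ + 4 * Real.pi * wOmega a θ T N := by rw [hC₀]; ring
  -- `N → ∞`
  refine le_of_forall_pos_le_add fun ε hε => ?_
  have hev := (tendsto_order.1 (tendsto_wOmega hw hCa hsa1 hsa2 hT)).2 (ε / (4 * Real.pi)) (by positivity)
  obtain ⟨n₀, hn₀⟩ := eventually_atTop.1 hev
  set N : ℕ := max n₀ (max (max L 1) K.toNat) with hN
  have hsmall : wOmega a θ T N < ε / (4 * Real.pi) := hn₀ N (le_max_left _ _)
  have hN1 : 1 ≤ N := by omega
  have hNL : (L : ℤ) ≤ N := by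
    have : L ≤ N := by omega
    exact_mod_cast this
  have hNK : K ≤ N := by
    have h1 : K.toNat ≤ N := by omega
    have h2 : K ≤ (K.toNat : ℤ) := Int.self_le_toNat K
    omega
  have hkey := key N hN1 hNL hNK
  have : 4 * Real.pi * wOmega a θ T N ≤ ε := by
    rw [lt_div_iff₀ (by positivity)] at hsmall; linarith
  linarith

/-- **Every finite set of modes** (Wiener-class stirring). [folklore] -/
theorem wien_finset_dissipation_le (hw : IsWeakScalarTransportForced ν u (fun _ => h) θ₀ θ) (hν : 0 ≤ ν)
    (hu : ∀ s, u s = wienField (C s)) (hCa : ∀ s q, ‖C s q‖ ≤ a q) (hsa : Summable a)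
    (hsa1 : Summable fun q => (qrad q : ℝ) * a q) (hsa2 : Summable fun q => (qrad q : ℝ) ^ 2 * a q)
    (hsymm : ∀ s q, C s (-q) = EuclideanSpace.conjVec (C s q)) (hcont : ∀ q, Continuous fun s => C s q)
    (htrans : ∀ s q, zdot q (C s q) = 0) (hh : MemLp h 2 volume) (hθ₀ : MemLp θ₀ 2 volume)
    {K : ℤ} (hK : 0 ≤ K) {T : ℝ} (hT : 0 < T) (F : Finset ℤ²) :
    2 * ν * ∑ p ∈ F, 4 * Real.pi ^ 2 * freqNormSq p * modeEnergyInt θ T p ≤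
      scalarL2Sq θ₀ + 16 * Real.pi ^ 2 * ν * K ^ 2 * (∫ t in Ioo 0 T, scalarL2Sq (θ t)) +
        4 * Real.pi * (∑' q, ∫ t in Ioo 0 T, wInner a K (modes θ t) q) +
        2 * sourceTailMass K K h * ∫ t in Ioo 0 T, Real.sqrt (scalarL2Sq (θ t)) := by
  classical
  have hsplit : ∑ p ∈ F, 4 * Real.pi ^ 2 * freqNormSq p * modeEnergyInt θ T p =
      ∑ p ∈ F.filter (fun p => p ∈ box K K), 4 * Real.pi ^ 2 * freqNormSq p * modeEnergyInt θ T p +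
      ∑ p ∈ F.filter (fun p => p ∉ box K K), 4 * Real.pi ^ 2 * freqNormSq p * modeEnergyInt θ T p :=
    (Finset.sum_filter_add_sum_filter_not F (fun p => p ∈ box K K) _).symm
  have hin : ∑ p ∈ F.filter (fun p => p ∈ box K K), 4 * Real.pi ^ 2 * freqNormSq p * modeEnergyInt θ T p ≤
      4 * Real.pi ^ 2 * (K ^ 2 + K ^ 2) * ∫ t in Ioo 0 T, scalarL2Sq (θ t) := by
    refine le_trans ?_ (box_dissipation_le hw hT)
    refine Finset.sum_le_sum_of_subset_of_nonneg (fun p hp => (Finset.mem_filter.1 hp).2) fun p _ _ => ?_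
    have := freqNormSq_nonneg p; have := modeEnergyInt_nonneg θ T p; positivity
  have hout := wien_compl_finset_dissipation_le hw hν hu hCa hsa hsa1 hsa2 hsymm hcont htrans hh hθ₀ hK hT
    (F := F.filter (fun p => p ∉ box K K)) fun p hp => (Finset.mem_filter.1 hp).2
  rw [hsplit, mul_add]
  nlinarith [hin, hout, hν]

/-- **Per-`T` dissipation inequality** under Wiener-class stirring:
`2ν ∫⁻_{(0,T)} ‖∇θ‖² ≤ ofReal (‖θ₀‖² + 16π²νK² ∫‖θ‖² + 4π ∑' q ∫ wInner a K y q + 2 η_K ∫‖θ‖)`. [folklore] -/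
theorem wien_perT_dissipation_le (hw : IsWeakScalarTransportForced ν u (fun _ => h) θ₀ θ) (hν : 0 ≤ ν)
    (hu : ∀ s, u s = wienField (C s)) (hCa : ∀ s q, ‖C s q‖ ≤ a q) (hsa : Summable a)
    (hsa1 : Summable fun q => (qrad q : ℝ) * a q) (hsa2 : Summable fun q => (qrad q : ℝ) ^ 2 * a q)
    (hsymm : ∀ s q, C s (-q) = EuclideanSpace.conjVec (C s q)) (hcont : ∀ q, Continuous fun s => C s q)
    (htrans : ∀ s q, zdot q (C s q) = 0) (hh : MemLp h 2 volume) (hθ₀ : MemLp θ₀ 2 volume)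
    {K : ℤ} (hK : 0 ≤ K) {T : ℝ} (hT : 0 < T) :
    ENNReal.ofReal (2 * ν) * ∫⁻ t in Ioo 0 T, eScalarGradNormSq (θ t) ≤
      ENNReal.ofReal (scalarL2Sq θ₀ + 16 * Real.pi ^ 2 * ν * K ^ 2 * (∫ t in Ioo 0 T, scalarL2Sq (θ t)) +
        4 * Real.pi * (∑' q, ∫ t in Ioo 0 T, wInner a K (modes θ t) q) +
        2 * sourceTailMass K K h * ∫ t in Ioo 0 T, Real.sqrt (scalarL2Sq (θ t))) := by
  rw [lintegral_grad_eq_iSup hw hT, ENNReal.mul_iSup]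
  refine iSup_le fun F => ?_
  rw [← ENNReal.ofReal_mul (by positivity)]
  exact ENNReal.ofReal_le_ofReal (wien_finset_dissipation_le hw hν hu hCa hsa hsa1 hsa2 hsymm hcont htrans hh hθ₀ hK hT F)

end WOuter

end Summit.AnomalousDissipation.AnomalousDissipation.Theorems.ScalarAnomalySteadySourceFormal.Negative
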